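import Literature.NumberTheory.LFunctions.Zhang2022.RepairIntakeBell

/-!
# Zhang (2022), programme F-S3 §E (cell landau-siegel, barrier extension, stub S-E-bell-2): MEMBERS of the §B-ell intake —
# the PHYSICAL class of KILL-CERT(B-ell) §2 (admissibility (a)–(f) on exponents, `x = 1` superset), the member records
# `DirectDesign` / `TwoSidedDesign` with the NAMED slots `BAH` / `HExp` / `HExpII`, and the BRIDGE lemmas from a member's
# slots INTO row 47's displayed premise `Repair.FirstOrderExpansion` of INTAKE-5 (`RepairIntakeBell`, p479175) —
# exhibiting in Lean the map «physical member ↦ premise shape» that the intake declares in prose (BARRIER-STATE §2′ N14)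

Y. Zhang, *Discrete mean estimates and the Landau–Siegel zero*, arXiv:2211.02515v1 [Zhang2022LandauSiegel] — an
unrefereed manuscript under adjudication. **WHAT THIS IS NOT: not a claim about Theorems 1–2 of arXiv:2211.02515, about
Landau–Siegel zeros, about a repaired `Margin232`, about Parity; not a new row of `Repair.Rplusplus` (NO `DesignFamily` is
declared here — ls-barrier-plan g1 2026-08-27T00:43:27Z (2)); not an evaluation of any member's dictionary data (every
`data`, `Q`, `𝓜` below stays SYMBOLIC — an evaluated datum would be a ROW EVALUATION, filed separately). The programme
SEARCHES and TYPES; no claim about Landau–Siegel zeros, Theorems 1–2 of arXiv:2211.02515 or a repaired Margin232 until a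
kernel theorem says so.**

POINTERS OF RECORD.  THE WORD «KILL(B-ell) INSIDE D_ell» — director-frontier g6, HOME/INBOX.md 2026-08-27T00:20:49Z
(riders R1/R2, qualifiers (a)(b)(c)); certificate KILL-CERT(B-ell) v1 = B-ell/KILL-draft.md v0.8 sha16 5625bef2660f98d2
(§2 «class D_ell» is quoted VERBATIM in INTAKE-5's module docstring); INTAKE-5 = `RepairIntakeBell` (p479175, tree bytes
= →ref 9049fbbc22c289e3; `Repair.bellWord` = rows 45–49 of `Repair.Rplusplus14` on ls-barrier-p1's append); this file =
row S-E-bell-2 (ls-barrier-plan g1 00:43:27Z (2): «the PHYSICAL-CLASS material … re-based on the landed file; imports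
RepairIntakeBell; `EllAdmissible` = §2 (a)–(f) typed on physical exponents with x = 1 superset + n7/n10 lemmas;
`DirectDesign`/`TwoSidedDesign` with the named slots `BAH`/`HExp`(/`HExpII`) and the bridge lemmas `expansion_of_slots` /
`modelConsistentOn_of_slots` INTO row 47's premise `FirstOrderExpansion`; C4 witnesses K₀-POS-001…003 / G5 v2 tie / G6
corner; NO new DesignFamily rows»); REF-E: INTAKE-5 MEMBERS addendum.

## What is here (member kind ↦ record ↦ class ↦ slots ↦ row of `bellWord` ↦ bridge)

| member kind (KILL-CERT §2 / R1) | record | class predicate (NO analytic hypothesis) | displayed slots | row of `bellWord` it inhabits | bridge (PROVED) |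
|---|---|---|---|---|---|
| K₀-POS (the complex plane `span_ℂ{k₁+k₂, k₂+k₃}`; rows K₀-POS-001…003) | `Repair.K0PlaneDesign` (INTAKE-5) | `0 ≤ τ₀` | none (TIER 2, unconditional) | row 45 `familyBellOnePiece` via `kbell_onePiece_expComb`, row 46 `familyBellK0Plane` via `kbell_k0Plane_rows` (INTAKE-5) | `k0Plane_slots` (its v0.2 data inhabit `BAH ∧ HExp` with `Q := value/A`), `vbell_firstOrder_of_k0Plane` (row 47 verdict HOLDS for the plane data, premise discharged by p472567) |
| formula-I LIST-U members: one-piece designs and the DIRECT piece of every §2 member (F-R σ′ = 0 limit, G5 v1/v2/v2b, G6, G2/G2b/G4/G4b, F-P, block C, CS-edge corner family, δ-family) | `DirectDesign` = physical exponents `e = (e₁,e₂,e₃,cut)`, sheet `σ = (τ, α̃)`, dict-1 data `(gain,G₀,G₁,G₂)`, model set `𝓜`, (A)-world form `Q`, `A₀`, `K` | `KDirect d := EllAdmissible 1 d.e d.σ` (§2 (a)–(f) at the conductor-natural cap `X = 1 + α̃ − 2τ`; the `x = 0` class ⊂ it: `ellAdmissible_zero_to_one` = audit n7) | `BAH d.𝓜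 d.Q d.A₀` (hQ = B-AH|_U, E-014; NAMED, proved by no one) · `HExp d.𝓜 d.Q d.data d.A₀ d.K` (hexp = E-022, derivation-reviewed in scope) | row 47 `familyBellFirstOrder`: `KBell (.firstOrder d.data d.𝓜)` (`kbell_firstOrder_of_direct`) | `firstOrderExpansion_of_slots` (the two slots ARE p470105's hypothesis: `FirstOrderExpansion d.𝓜 d.data`), `vbell_firstOrder_of_direct` (⇒ row 47's verdict, i.e. `ModelConsistentOn`), `direct_not_closes` (no robust closing over any box meeting `𝓜`) |
| tie/CS members WITH a reflected formula-II piece (two-sided supports; RIDER R1) | `TwoSidedDesign` = as above with TWO data quadruples / forms: direct piece `dataI, QI, K₁`, reflected piece `dataII, QII, K₂` (`QII` = whole form minus the direct piece: reflected square AND cross term; hexp_II expands all of it) | `KTwoSided d := EllAdmissible 1 d.e d.σ` | `BAH d.𝓜 (QI + QII) d.A₀` (hQ on `U ∪ U_II`) · `HExp … QI dataI … K₁` (hexp) · `HExpII … QII dataII … K₂` (**hexp_II = D-ELL-1c-II, OWED**, RIDER R2; the slot the director's qualifier (b) watches) | row 47 with the SUMMED data: `KBell (.firstOrder (addData dataI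 dataII) d.𝓜)` | `hexp_add` (two expansions ⇒ the expansion of the sum, `firstOrderValue_addData`), `firstOrderExpansion_of_twoSided_slots`, `vbell_firstOrder_of_twoSided`, `twoSided_not_closes` |

CS-sheet reading: a member's tie/CS data `(D₀,D₁,J₀,J₁,X₀,X₁)` at a CS-edge corner (`D₀J₀ = X₀²`) with its exact-CS slot
IS INTAKE-5's `CSExactExpansion` and inhabits row 48 `familyBellCSEdge` directly (`Repair.kbell_csEdge`-type membership;
nothing to bridge).  ELL-E members: row 49 (`Repair.kbell_subcritical`).  NOT here: any `DesignFamily`, any evaluated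
dictionary datum, any number of the word; the exponent witnesses are the rationals of §2's own formulas (C4).

C4 WITNESSES (DESIGN-MAP-ell v1.0.4 cf494b9d05381eb3 rows; exponents = §2 formulas, data symbolic): K₀-POS-001…003 ↦
INTAKE-5's `kbell_k0Plane_rows` / `kbell_onePiece_expComb` and, as row-47 data, `vbell_firstOrder_of_k0Plane`; a G5 v2
σ′-deformed tie (ell-G5 family, formulas of B-ell/designs/ell-G5v2-sigma.json: `cut = z₂ = ½ − σ′`, `z₁ = cut + δ`,
`z₃ = ½ + σ′ − δ/2`, physical `e = z/λ`, `λ = A/(A+1+2B)`) read at `σ′ = 0` on the reference sheet `B = 0`, `x = 1`,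
`A = 1000`, `δ = 1/10` ↦ `directG5v2` (`kdirect_G5v2` by `norm_num`; and `expG5v2_not_admissible_zero`: the same exponents
FAIL the P-sharp cap `x = 0` — audit n10: the σ′ = 0 tie is the F-R limit, inadmissible at `x = 0`, a member of the
`x = 1` superset only); the G6 CS-edge corner family (`z₃ = z₂ = cut = c`, `δ = 2(1−2c)`) at `c = 9/20` on the MAIN sheet
`B = 51/100`, `A = 1000`, `x = 1` ↦ `twoSidedG6corner` (`ktwoSided_G6corner`).

C3: the slots are INHABITED (`k0Plane_slots`: the K₀ row `k₁ − k₃`, printed frame, with `Q := value/A`) and each is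
LOAD-BEARING (`hQ_loadBearing`: the datum `(−1,0,0,0)` with `Q := value/A` has hexp but not hQ and no model-consistency;
`hexp_loadBearing`: `Q ≡ 0` has hQ but, with that datum, not the conclusion; `direct_unpremised_fails`: an ADMISSIBLE
`DirectDesign` (the G5 v2 exponents) with that datum is not model-consistent — the verdict is false as an unpremised schema).

## NOTES TO INTAKE-5 carried here (ls-barrier-plan g1 00:46:49Z: «errata go into S-E-bell-2, never a re-file»)

(n-α, REF-B2 intake read 00:35:30Z) INTAKE-5's displayed premise `Repair.FirstOrderExpansion 𝓜 data` has the ∃Q-shape of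
p470105's hypothesis and, as a bare `Prop`, is EQUIVALENT to row 47's verdict `ModelConsistentOn 𝓜 data`
(⇐ `Repair.firstOrderExpansion_of_modelConsistentOn`, ⇒ p470105): the row is the word's «kernel implication schema»;
its CONTENT is the identification of `Q` with the (A)-model's exact form of the MEMBER (hQ = E-014|_U) and of `data`
with the member's dict-1 coefficients (hexp = E-022) — which THIS file makes explicit: with `Q` a displayed FIELD of the
member record, the slots `BAH` / `HExp` are no longer jointly equivalent to the verdict instance by instance
(`hQ_loadBearing`, `hexp_loadBearing`; REF-B2 pre-read 00:45:36Z (iv)).  (n-β) `EllRegime.firstOrderValue` carries no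
`A·F(d)` term: rows 47/48 read designs on the MAIN-ORDER ZERO LOCUS (`K₀`-type profiles, CS-edge corners
`D₀J₀ = X₀²`) — the only first-order-closable ones; members with a positive main-order limit are disposed AT MAIN ORDER
(row 45; for the tie/CS class the word's §1 (II) «bounded windows located by two-lineage numerics, immaterial to the
word — the family's objective is declared to first order in 1/A»).  (w-K1, K_ell 00:31:18Z) the second half of §2's
FIXED-DESIGN clause, echoed: A-indexed collections (the corner family re-tuned per `A`, the G6 argmax per grid point, the
REACH anchors, scale-free σ′ windows at δ fixed per design) enter INSTANCE-BY-INSTANCE as fixed designs at each `A`;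
profile structure at scales shrinking with `A` (`y ≲ 1/A`, the wall layer) is OUTSIDE `D_ell` = an (α)/U4-type §D
object.  (row granularity / qualifier (b)) RIDER R1 draws the formula-I / formula-II line BY PIECE; INTAKE-5 renders it
inside row 47's premise text and THIS file renders it as the two member records (`DirectDesign`: hQ ∧ hexp;
`TwoSidedDesign`: hQ ∧ hexp ∧ hexp_II) mapping into the SAME row 47; if the director's qualifier (b) SUSPENDS the
reflected piece of the two-sided members at 05:00Z, row 47 is flagged by docstring erratum + BARRIER-STATE §2′ line,
`HExpII`-carrying members are the suspended ones, nothing is deleted (barrier-plan 00:30:01Z / 00:43:27Z).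

## References
* Y. Zhang, arXiv:2211.02515v1 (2022): §2 (2.10), (2.13), (2.21), (2.23)–(2.25), (2.28)–(2.30), (2.32)–(2.33),
  Lemma 2.3; §7 (7.2); §8 (8.23); §9 (9.1); §12 Lemma 12.3; §14 (14.2); §15 (15.2).
  [cite: Zhang2022LandauSiegel, §2 (2.21), (2.32); §7 (7.2); §14 (14.2); §15 (15.2)]

«The programme SEARCHES and TYPES; no claim about Landau–Siegel zeros, Theorems 1–2 of arXiv:2211.02515 or a
repaired Margin232 until a kernel theorem says so.»
-/

noncomputable section

open Complex Real Set MeasureTheory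
open scoped ComplexConjugate

namespace Literature.NumberTheory.LFunctions.Zhang2022

namespace Repair

open EllRegime EllScales Skeleton

/-! ### Part 1 — §2 admissibility on PHYSICAL exponents (the class of the formula-I / two-sided members) -/

/-- Physical length exponents of a design (KILL-CERT §2 «Pieces of a design»): side-1 dual profile on `[0, cut] ∪
[cut, e₁]` (probe), side-2 on `[0, e₂]`, side-3 on `[0, e₃]` — exponents of `P`. [cite: Zhang2022LandauSiegel, §2 (2.21), (2.28)–(2.29); §7 (7.2); §15 (15.2)] -/
structure EllExponents : Type where
  /-- side-1 top exponent `e₁` -/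
  e₁ : ℝ
  /-- side-2 top exponent `e₂` (physical: `ν₂ − 10τ_T`) -/
  e₂ : ℝ
  /-- side-3 top exponent `e₃` -/
  e₃ : ℝ
  /-- side-1 cut exponent -/
  cut : ℝ

/-- The sheet's regime exponents: `τ = τ_T = log T/log P = B/A` and `α̃ = τ_{Dt₀} = log(Dt₀)/log P` (`= (1+2B)/A` on
the `T`-room sheets `t₀ = T²`). [cite: Zhang2022LandauSiegel, §2 (2.6), (2.30); §6] -/
structure EllSheet : Type where
  /-- `τ = B/A` -/
  tauT : ℝ
  /-- `α̃ = log(Dt₀)/log P` -/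
  alphaT : ℝ

/-- The support cap `X = 1 + x·α̃ − 2τ` of §2 (a)(b): `x = 0` P-sharp caps (large-sieve/orthogonality origin),
`x = 1` conductor-natural caps (AFE-truncation origin) — theory (α): caps decided by origin; the KILL quantifies over
the larger class `x = 1`. [cite: Zhang2022LandauSiegel, §14 (14.2); §15 (15.2)] -/
def capX (x : ℝ) (σ : EllSheet) : ℝ := 1 + x * σ.alphaT - 2 * σ.tauT

/-- **§2 ADMISSIBILITY (a)–(f)** (KILL-CERT(B-ell) v1 §2 verbatim: «(a) 2e₂ ≤ X, (b) cut+e₂ ≤ X, (c) e₃ ≤ e₂,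
(d) e_j < 1−2τ, (e) e₁+e₂ > 1+α̃, (f) e₁+e₃ > 1, X = 1 + x·α̃ − 2τ»; = the printed ν-slab with `T`-rooms on physical
exponents, PARAMS §7 (i)–(vii) ≙ `EllRegime.TExponentConstraints`).  A DEFINITION (class predicate; no analytic
hypothesis). [cite: Zhang2022LandauSiegel, §2 (2.21); §7 (7.2); §12 Lemma 12.3; §14 (14.2); §15 (15.2)] -/
def EllAdmissible (x : ℝ) (e : EllExponents) (σ : EllSheet) : Prop :=
  2 * e.e₂ ≤ capX x σ ∧ e.cut + e.e₂ ≤ capX x σ ∧ e.e₃ ≤ e.e₂ ∧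
    (e.e₁ < 1 - 2 * σ.tauT ∧ e.e₂ < 1 - 2 * σ.tauT ∧ e.e₃ < 1 - 2 * σ.tauT) ∧
    1 + σ.alphaT < e.e₁ + e.e₂ ∧ 1 < e.e₁ + e.e₃

/-- **(audit n7): the `x = 0` class is INSIDE the `x = 1` class** (for `α̃ ≥ 0`): the KILL certified on the superset
covers the P-sharp class. [cite: Zhang2022LandauSiegel, §14 (14.2); §15 (15.2)] -/
theorem ellAdmissible_zero_to_one {e : EllExponents} {σ : EllSheet} (hα : 0 ≤ σ.alphaT)
    (h : EllAdmissible 0 e σ) : EllAdmissible 1 e σ := by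
  obtain ⟨ha, hb, hc, hd, he, hf⟩ := h
  have hX : capX 0 σ ≤ capX 1 σ := by unfold capX; nlinarith
  exact ⟨ha.trans hX, hb.trans hX, hc, hd, he, hf⟩

/-! ### Part 2 — the displayed slots of TIER 1, NAMED (the hypotheses of p470105, not typed anew), and their algebra -/

/-- **Slot hQ — B-AH restricted to the list** (`U` for a direct piece, `U ∪ U_II` for a two-sided member): the
(A)-world's exact form `Q_A(d; p)` is `≥ 0` at every model-admissible datum `p ∈ 𝓜` for `A ≥ A₀` (registry E-014 at the
undressed model point; NAMED, proved by no one).  A DEFINITION (displayed hypothesis shape). [cite: Zhang2022LandauSiegel, §2 Lemma 2.3, (2.15), (2.32)] -/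
def BAH (𝓜 : Set (ℝ × ℝ)) (Q : ℝ × ℝ → ℝ → ℝ) (A₀ : ℝ) : Prop :=
  ∀ p ∈ 𝓜, ∀ A, A₀ ≤ A → 0 ≤ Q p A

/-- **Slot hexp — dict-1 IS the model's `1/A`-expansion** of that form with zeroth order `0`:
`|Q_A(p) − value(p)/A| ≤ K/A²` on `𝓜` for `A ≥ A₀` (registry E-022, formula I: derivation-reviewed in scope).
A DEFINITION (displayed hypothesis shape). [cite: Zhang2022LandauSiegel, §2 (2.13), (2.32); §8 (8.23), Lemmas 8.2–8.4] -/
def HExp (𝓜 : Set (ℝ × ℝ)) (Q : ℝ × ℝ → ℝ → ℝ) (data : ℝ × ℝ × ℝ × ℝ) (A₀ K : ℝ) : Prop :=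
  ∀ p ∈ 𝓜, ∀ A, A₀ ≤ A → |Q p A - firstOrderValue data.1 data.2.1 data.2.2.1 data.2.2.2 p / A| ≤ K / A ^ 2

/-- **Slot hexp_II — the expansion of the REFLECTED (formula-II) piece** of a two-sided member: the SAME shape as
`HExp`, on the reflected piece's form and data; its content = D-ELL-1c-II (**OWED**, RIDER R2; the slot the director's
qualifier (b) watches at 05:00Z).  A DEFINITION (displayed hypothesis shape). [cite: Zhang2022LandauSiegel, §2 (2.32); §9 (9.1); §12 (12.8)] -/
def HExpII (𝓜 : Set (ℝ × ℝ)) (QII : ℝ × ℝ → ℝ → ℝ) (dataII : ℝ × ℝ × ℝ × ℝ) (A₀ K₂ : ℝ) : Prop :=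
  HExp 𝓜 QII dataII A₀ K₂

/-- The two slots give INTAKE-5's displayed premise `Repair.FirstOrderExpansion 𝓜 data` (= p470105's hypothesis), with
`A₀ ↦ max A₀ 1 > 0`. [cite: Zhang2022LandauSiegel, §2 Lemma 2.3, (2.32)] -/
theorem firstOrderExpansion_of_slots {𝓜 : Set (ℝ × ℝ)} {Q : ℝ × ℝ → ℝ → ℝ} {data : ℝ × ℝ × ℝ × ℝ} {A₀ K : ℝ}
    (hQ : BAH 𝓜 Q A₀) (hexp : HExp 𝓜 Q data A₀ K) : FirstOrderExpansion 𝓜 data :=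
  fun p hp => ⟨max A₀ 1, K, Q p, lt_of_lt_of_le one_pos (le_max_right _ _),
    fun A hA => hQ p hp A (le_trans (le_max_left _ _) hA),
    fun A hA => hexp p hp A (le_trans (le_max_left _ _) hA)⟩

/-- Alias under the ruling's name: the slots give p470105's expansion hypothesis. [cite: Zhang2022LandauSiegel, §2 Lemma 2.3, (2.32)] -/
theorem expansion_of_slots {𝓜 : Set (ℝ × ℝ)} {Q : ℝ × ℝ → ℝ → ℝ} {data : ℝ × ℝ × ℝ × ℝ} {A₀ K : ℝ}
    (hQ : BAH 𝓜 Q A₀) (hexp : HExp 𝓜 Q data A₀ K) : FirstOrderExpansion 𝓜 data :=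
  firstOrderExpansion_of_slots hQ hexp

/-- **TIER 1 from the slots** (row 47's verdict): hQ ∧ hexp ⇒ the first-order value is `≥ 0` on `𝓜`
(`Repair.familyBellFirstOrder_decided`, i.e. `EllRegime.modelConsistentOn_of_expansion`, p470105).
[cite: Zhang2022LandauSiegel, §2 Lemma 2.3, (2.32)] -/
theorem modelConsistentOn_of_slots {𝓜 : Set (ℝ × ℝ)} {Q : ℝ × ℝ → ℝ → ℝ} {data : ℝ × ℝ × ℝ × ℝ} {A₀ K : ℝ}
    (hQ : BAH 𝓜 Q A₀) (hexp : HExp 𝓜 Q data A₀ K) :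
    ModelConsistentOn 𝓜 data.1 data.2.1 data.2.2.1 data.2.2.2 :=
  familyBellFirstOrder_decided (data, 𝓜) trivial (firstOrderExpansion_of_slots hQ hexp)

/-- Componentwise sum of two first-order data quadruples (direct piece + reflected piece).
[cite: Zhang2022LandauSiegel, §2 (2.32); §9 (9.1)] -/
def addData (a b : ℝ × ℝ × ℝ × ℝ) : ℝ × ℝ × ℝ × ℝ :=
  (a.1 + b.1, a.2.1 + b.2.1, a.2.2.1 + b.2.2.1, a.2.2.2 + b.2.2.2)

/-- The first-order value is additive in the data. [cite: Zhang2022LandauSiegel, §2 (2.32); §9 (9.1)] -/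
theorem firstOrderValue_addData (a b : ℝ × ℝ × ℝ × ℝ) (p : ℝ × ℝ) :
    firstOrderValue (addData a b).1 (addData a b).2.1 (addData a b).2.2.1 (addData a b).2.2.2 p =
      firstOrderValue a.1 a.2.1 a.2.2.1 a.2.2.2 p + firstOrderValue b.1 b.2.1 b.2.2.1 b.2.2.2 p := by
  simp only [firstOrderValue, addData]
  ring

/-- Two expansion slots (direct `QI` vs `dataI`, reflected `QII` vs `dataII`) give the expansion slot of the SUM
(the two-sided member's total form `QI + QII` against `dataI + dataII`). [cite: Zhang2022LandauSiegel, §2 (2.32); §9 (9.1)] -/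
theorem hexp_add {𝓜 : Set (ℝ × ℝ)} {QI QII : ℝ × ℝ → ℝ → ℝ} {dataI dataII : ℝ × ℝ × ℝ × ℝ} {A₀ K₁ K₂ : ℝ}
    (h₁ : HExp 𝓜 QI dataI A₀ K₁) (h₂ : HExpII 𝓜 QII dataII A₀ K₂) :
    HExp 𝓜 (fun p A => QI p A + QII p A) (addData dataI dataII) A₀ (K₁ + K₂) := by
  intro p hp A hA
  have e1 := h₁ p hp A hA
  have e2 := h₂ p hp A hA
  rw [firstOrderValue_addData, add_div, add_div]
  calc |QI p A + QII p A - (firstOrderValue dataI.1 dataI.2.1 dataI.2.2.1 dataI.2.2.2 p / A +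
          firstOrderValue dataII.1 dataII.2.1 dataII.2.2.1 dataII.2.2.2 p / A)|
        = |(QI p A - firstOrderValue dataI.1 dataI.2.1 dataI.2.2.1 dataI.2.2.2 p / A) +
            (QII p A - firstOrderValue dataII.1 dataII.2.1 dataII.2.2.1 dataII.2.2.2 p / A)| := by ring_nf
    _ ≤ |QI p A - firstOrderValue dataI.1 dataI.2.1 dataI.2.2.1 dataI.2.2.2 p / A| +
          |QII p A - firstOrderValue dataII.1 dataII.2.1 dataII.2.2.1 dataII.2.2.2 p / A| := abs_add_le _ _
    _ ≤ K₁ / A ^ 2 + K₂ / A ^ 2 := add_le_add e1 e2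

/-! ### Part 3 — member records: `DirectDesign` (formula-I list-U members) and `TwoSidedDesign` (R1's two-sided members) -/

/-- A formula-I member (a one-piece design, or the DIRECT piece of any §2 member): physical exponents and sheet
(class), and — carried UNEVALUATED — its dict-1 first-order data `(gain, G₀, G₁, G₂)`, the model-admissible set `𝓜` of
its sheet, the (A)-world form `Q` with `A₀`, `K`. [cite: Zhang2022LandauSiegel, §2 (2.13), (2.21), (2.32); §8 (8.23)] -/
structure DirectDesign : Type where
  /-- physical exponents `(e₁, e₂, e₃, cut)` -/
  e : EllExponents
  /-- sheet `(τ, α̃)` -/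
  σ : EllSheet
  /-- dict-1 data `(gain, G₀, G₁, G₂)(d)` -/
  data : ℝ × ℝ × ℝ × ℝ
  /-- model-admissible set `𝓜` of `(λ, c′)` -/
  𝓜 : Set (ℝ × ℝ)
  /-- the (A)-world's exact form `p ↦ (A ↦ Q_A(d; p))` -/
  Q : ℝ × ℝ → ℝ → ℝ
  /-- threshold `A₀` -/
  A₀ : ℝ
  /-- remainder constant `K` -/
  K : ℝ

/-- Class of a formula-I member: §2 admissibility at the conductor-natural cap (`x = 1` superset).
[cite: Zhang2022LandauSiegel, §2 (2.21); §14 (14.2); §15 (15.2)] -/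
def KDirect (d : DirectDesign) : Prop := EllAdmissible 1 d.e d.σ

/-- A two-sided member (tie/CS design with a reflected formula-II piece): as `DirectDesign`, with TWO data quadruples
and TWO forms — the direct piece `dataI, QI, K₁` and the reflected piece `dataII, QII, K₂`; the (A)-world form of the
design is `QI + QII`, its dict-1 datum `dataI + dataII` (so `QII :=` the member's WHOLE exact form minus its formula-I
direct piece: the reflected-square `|H₂|²`-type term AND the cross term `2Re Z(ρ,χψ)⁻¹H₁H̄₂` of the print's (8.2)/(8.5);
hexp_II = D-ELL-1c-II expands ALL of it — REF-B2 00:55:09Z (m-1), his D-ELL-1c-II checklist's JOINT item).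
[cite: Zhang2022LandauSiegel, §2 (2.13), (2.21), (2.32); §8 (8.2), (8.5); §9 (9.1); §12 (12.8)] -/
structure TwoSidedDesign : Type where
  /-- physical exponents `(e₁, e₂, e₃, cut)` -/
  e : EllExponents
  /-- sheet `(τ, α̃)` -/
  σ : EllSheet
  /-- dict-1 data of the direct piece -/
  dataI : ℝ × ℝ × ℝ × ℝ
  /-- dict-1 data of the reflected piece (D-ELL-1c-II) -/
  dataII : ℝ × ℝ × ℝ × ℝ
  /-- model-admissible set `𝓜` -/
  𝓜 : Set (ℝ × ℝ)
  /-- form of the direct piece -/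
  QI : ℝ × ℝ → ℝ → ℝ
  /-- form of the reflected piece -/
  QII : ℝ × ℝ → ℝ → ℝ
  /-- threshold `A₀` -/
  A₀ : ℝ
  /-- remainder constant of the direct expansion -/
  K₁ : ℝ
  /-- remainder constant of the reflected expansion -/
  K₂ : ℝ

/-- Class of a two-sided member: §2 admissibility at `x = 1`. [cite: Zhang2022LandauSiegel, §2 (2.21); §14 (14.2); §15 (15.2)] -/
def KTwoSided (d : TwoSidedDesign) : Prop := EllAdmissible 1 d.e d.σ

/-! ### Part 4 — the BRIDGES into INTAKE-5's row 47 (`familyBellFirstOrder`) -/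

/-- A formula-I member inhabits row 47 with its own data (the row's class is unrestricted; the content is the premise).
[cite: Zhang2022LandauSiegel, §2 (2.32)] -/
theorem kbell_firstOrder_of_direct (d : DirectDesign) : KBell (.firstOrder d.data d.𝓜) := trivial

/-- **Bridge (direct): the member's slots ARE row 47's displayed premise.** [cite: Zhang2022LandauSiegel, §2 Lemma 2.3, (2.32)] -/
theorem firstOrderExpansion_of_direct (d : DirectDesign) (hQ : BAH d.𝓜 d.Q d.A₀) (hexp : HExp d.𝓜 d.Q d.data d.A₀ d.K) :
    FirstOrderExpansion d.𝓜 d.data :=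
  firstOrderExpansion_of_slots hQ hexp

/-- **Bridge (direct): GIVEN hQ ∧ hexp, row 47's VERDICT holds for the member** (`ModelConsistentOn 𝓜 data`).
[cite: Zhang2022LandauSiegel, §2 Lemma 2.3, (2.32)] -/
theorem vbell_firstOrder_of_direct (d : DirectDesign) (hQ : BAH d.𝓜 d.Q d.A₀) (hexp : HExp d.𝓜 d.Q d.data d.A₀ d.K) :
    ModelConsistentOn d.𝓜 d.data.1 d.data.2.1 d.data.2.2.1 d.data.2.2.2 :=
  familyBell_decided (.firstOrder d.data d.𝓜) trivial (firstOrderExpansion_of_direct d hQ hexp)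

/-- **Reading (direct): no robust first-order closing over any box `M` meeting `𝓜`** (`Repair.firstOrder_not_closes`).
[cite: Zhang2022LandauSiegel, §2 Lemma 2.3, (2.32)] -/
theorem direct_not_closes (d : DirectDesign) (hQ : BAH d.𝓜 d.Q d.A₀) (hexp : HExp d.𝓜 d.Q d.data d.A₀ d.K)
    {M : Set (ℝ × ℝ)} (hmeet : (d.𝓜 ∩ M).Nonempty) :
    ¬ ClosesFirstOrderOn M d.data.1 d.data.2.1 d.data.2.2.1 d.data.2.2.2 :=
  firstOrder_not_closes (firstOrderExpansion_of_direct d hQ hexp) hmeet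

/-- A two-sided member inhabits row 47 with its SUMMED data. [cite: Zhang2022LandauSiegel, §2 (2.32); §9 (9.1)] -/
theorem kbell_firstOrder_of_twoSided (d : TwoSidedDesign) : KBell (.firstOrder (addData d.dataI d.dataII) d.𝓜) :=
  trivial

/-- **Bridge (two-sided): hQ on the total form ∧ hexp ∧ hexp_II ⇒ row 47's displayed premise for the summed data.**
[cite: Zhang2022LandauSiegel, §2 Lemma 2.3, (2.32); §9 (9.1)] -/
theorem firstOrderExpansion_of_twoSided (d : TwoSidedDesign) (hQ : BAH d.𝓜 (fun p A => d.QI p A + d.QII p A) d.A₀)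
    (hexp : HExp d.𝓜 d.QI d.dataI d.A₀ d.K₁) (hexpII : HExpII d.𝓜 d.QII d.dataII d.A₀ d.K₂) :
    FirstOrderExpansion d.𝓜 (addData d.dataI d.dataII) :=
  firstOrderExpansion_of_slots hQ (hexp_add hexp hexpII)

/-- **Bridge (two-sided): GIVEN the three slots, row 47's VERDICT holds for the member's total first-order datum.**
[cite: Zhang2022LandauSiegel, §2 Lemma 2.3, (2.32); §9 (9.1)] -/
theorem vbell_firstOrder_of_twoSided (d : TwoSidedDesign) (hQ : BAH d.𝓜 (fun p A => d.QI p A + d.QII p A) d.A₀)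
    (hexp : HExp d.𝓜 d.QI d.dataI d.A₀ d.K₁) (hexpII : HExpII d.𝓜 d.QII d.dataII d.A₀ d.K₂) :
    ModelConsistentOn d.𝓜 (addData d.dataI d.dataII).1 (addData d.dataI d.dataII).2.1
      (addData d.dataI d.dataII).2.2.1 (addData d.dataI d.dataII).2.2.2 :=
  familyBell_decided (.firstOrder (addData d.dataI d.dataII) d.𝓜) trivial
    (firstOrderExpansion_of_twoSided d hQ hexp hexpII)

/-- **Reading (two-sided): no robust first-order closing over any box `M` meeting `𝓜`.**
[cite: Zhang2022LandauSiegel, §2 Lemma 2.3, (2.32); §9 (9.1)] -/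
theorem twoSided_not_closes (d : TwoSidedDesign) (hQ : BAH d.𝓜 (fun p A => d.QI p A + d.QII p A) d.A₀)
    (hexp : HExp d.𝓜 d.QI d.dataI d.A₀ d.K₁) (hexpII : HExpII d.𝓜 d.QII d.dataII d.A₀ d.K₂) {M : Set (ℝ × ℝ)}
    (hmeet : (d.𝓜 ∩ M).Nonempty) :
    ¬ ClosesFirstOrderOn M (addData d.dataI d.dataII).1 (addData d.dataI d.dataII).2.1
      (addData d.dataI d.dataII).2.2.1 (addData d.dataI d.dataII).2.2.2 :=
  firstOrder_not_closes (firstOrderExpansion_of_twoSided d hQ hexp hexpII) hmeet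

/-- **The K₀ plane inside row 47, premise DISCHARGED**: the v0.2 plane data of a `K0PlaneDesign` (INTAKE-5) inhabit
`BAH ∧ HExp` with the exact form `Q_A := value/A` (`K = 0`), by `modelConsistentOn_k0Plane` (p472567) — the TIER-2 row
is the TIER-1 schema with its premise proved. [cite: Zhang2022LandauSiegel, §2 Lemma 2.3, (2.13), (2.32)] -/
theorem k0Plane_slots (d : K0PlaneDesign) (h : familyBellK0Plane.InClass d) :
    BAH (k0Model d.τ₀ d.l₁)
        (fun p A => firstOrderValue 0 (k0G₀ d.ι₁ d.ι₂ d.τ₀) (k0G₁ d.ι₁ d.ι₂) (k0G₂ d.ι₁ d.ι₂) p / A) 1 ∧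
      HExp (k0Model d.τ₀ d.l₁)
        (fun p A => firstOrderValue 0 (k0G₀ d.ι₁ d.ι₂ d.τ₀) (k0G₁ d.ι₁ d.ι₂) (k0G₂ d.ι₁ d.ι₂) p / A)
        (0, k0G₀ d.ι₁ d.ι₂ d.τ₀, k0G₁ d.ι₁ d.ι₂, k0G₂ d.ι₁ d.ι₂) 1 0 := by
  have hmc := familyBellK0Plane_decided d h
  exact ⟨fun p hp A hA => div_nonneg (hmc p hp) (le_trans zero_le_one hA), fun p _ A _ => by simp⟩

/-- Row 47's verdict for the plane data (from INTAKE-5's `k0Plane` row, no premise left). [cite: Zhang2022LandauSiegel, §2 Lemma 2.3, (2.13), (2.32)] -/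
theorem vbell_firstOrder_of_k0Plane (d : K0PlaneDesign) (h : familyBellK0Plane.InClass d) :
    VBell (.firstOrder (0, k0G₀ d.ι₁ d.ι₂ d.τ₀, k0G₁ d.ι₁ d.ι₂, k0G₂ d.ι₁ d.ι₂) (k0Model d.τ₀ d.l₁)) :=
  fun _ => familyBellK0Plane_decided d h

/-! ### Part 5 — C4 witnesses (DESIGN-MAP-ell rows; exponents = §2 formulas, data symbolic) and C3 -/

/-- The G5 v2 tie's physical exponents at `σ′ = 0` on the reference sheet `B = 0`, `x = 1`, `A = 1000`, `δ = 1/10`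
(reflection frame `cut = z₂ = 1/2`, `z₁ = 1/2 + δ`, `z₃ = 1/2 − δ/2`; physical `e = z·(A+1)/A`): `e₁ = 3003/5000`,
`e₂ = cut = 1001/2000`, `e₃ = 9009/20000`. [cite: Zhang2022LandauSiegel, §2 (2.21), (2.28)–(2.29)] -/
def expG5v2 : EllExponents := ⟨3003 / 5000, 1001 / 2000, 9009 / 20000, 1001 / 2000⟩

/-- The reference sheet `B = 0` at `A = 1000`: `τ = 0`, `α̃ = 1/A = 1/1000`. [cite: Zhang2022LandauSiegel, §2 (2.6), (2.30)] -/
def sheetB0 : EllSheet := ⟨0, 1 / 1000⟩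

/-- The G6 CS-edge corner family at `c = 9/20` on the MAIN sheet `B = 51/100`, `A = 1000`, `x = 1` (`z₃ = z₂ = cut = c`,
`δ = 2(1−2c) = 1/5`, `z₁ = 13/20`; physical `e = z·(A+1+2B)/A = z·50101/50000`): `e₁ = 651313/10⁶`,
`e₂ = e₃ = cut = 450909/10⁶`. [cite: Zhang2022LandauSiegel, §2 (2.21), (2.28)–(2.29)] -/
def expG6corner : EllExponents := ⟨651313 / 1000000, 450909 / 1000000, 450909 / 1000000, 450909 / 1000000⟩

/-- The main sheet `B = 51/100` at `A = 1000`: `τ = B/A = 51/100000`, `α̃ = (1+2B)/A = 101/50000`.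
[cite: Zhang2022LandauSiegel, §2 (2.6), (2.30)] -/
def sheetB51 : EllSheet := ⟨51 / 100000, 101 / 50000⟩

/-- C4: the G5 v2 tie (σ′ = 0, sheet `B = 0`, `x = 1`, `A = 1000`) as a formula-I member, with WHATEVER dict-1 data /
model set / form it carries (none evaluated here). [cite: Zhang2022LandauSiegel, §2 (2.21), (2.32)] -/
def directG5v2 (data : ℝ × ℝ × ℝ × ℝ) (𝓜 : Set (ℝ × ℝ)) (Q : ℝ × ℝ → ℝ → ℝ) (A₀ K : ℝ) : DirectDesign :=
  ⟨expG5v2, sheetB0, data, 𝓜, Q, A₀, K⟩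

/-- C4: the G5 v2 member is ADMISSIBLE (`x = 1`), by `norm_num` on §2 (a)–(f). [cite: Zhang2022LandauSiegel, §2 (2.21); §15 (15.2)] -/
theorem kdirect_G5v2 (data : ℝ × ℝ × ℝ × ℝ) (𝓜 : Set (ℝ × ℝ)) (Q : ℝ × ℝ → ℝ → ℝ) (A₀ K : ℝ) :
    KDirect (directG5v2 data 𝓜 Q A₀ K) := by
  change EllAdmissible 1 expG5v2 sheetB0
  norm_num [EllAdmissible, capX, expG5v2, sheetB0]

/-- (audit n10) at the P-sharp cap `x = 0` the same exponents are NOT admissible on the `B = 0` sheet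
(`2e₂ = 1 + 1/A > X = 1`): the `σ′ = 0` tie is the F-R limit, inadmissible at `x = 0` — the witness sits in the
`x = 1` superset only, as the word's n7/n10 say. [cite: Zhang2022LandauSiegel, §15 (15.2)] -/
theorem expG5v2_not_admissible_zero : ¬ EllAdmissible 0 expG5v2 sheetB0 := by
  norm_num [EllAdmissible, capX, expG5v2, sheetB0]

/-- C4: the G6 CS-edge corner family at `c = 9/20` on the main sheet as a two-sided member, with whatever data it
carries. [cite: Zhang2022LandauSiegel, §2 (2.21), (2.32)] -/
def twoSidedG6corner (dI dII : ℝ × ℝ × ℝ × ℝ) (𝓜 : Set (ℝ × ℝ)) (QI QII : ℝ × ℝ → ℝ → ℝ) (A₀ K₁ K₂ : ℝ) :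
    TwoSidedDesign :=
  ⟨expG6corner, sheetB51, dI, dII, 𝓜, QI, QII, A₀, K₁, K₂⟩

/-- C4: the G6 corner member is ADMISSIBLE (`x = 1`, main sheet). [cite: Zhang2022LandauSiegel, §2 (2.21); §15 (15.2)] -/
theorem ktwoSided_G6corner (dI dII : ℝ × ℝ × ℝ × ℝ) (𝓜 : Set (ℝ × ℝ)) (QI QII : ℝ × ℝ → ℝ → ℝ) (A₀ K₁ K₂ : ℝ) :
    KTwoSided (twoSidedG6corner dI dII 𝓜 QI QII A₀ K₁ K₂) := by
  change EllAdmissible 1 expG6corner sheetB51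
  norm_num [EllAdmissible, capX, expG6corner, sheetB51]

/-- C3 — hQ is LOAD-BEARING: the datum `(−1, 0, 0, 0)` with `Q_A := value/A = −1/A` satisfies hexp (`K = 0`) but is NOT
model-consistent on any non-empty `𝓜` (so hQ fails for it). [cite: Zhang2022LandauSiegel, §2 (2.32)] -/
theorem hQ_loadBearing :
    HExp (Set.univ : Set (ℝ × ℝ)) (fun p A => firstOrderValue (-1) 0 0 0 p / A) ((-1 : ℝ), (0 : ℝ), (0 : ℝ), (0 : ℝ)) 1 0 ∧
      ¬ ModelConsistentOn (Set.univ : Set (ℝ × ℝ)) (-1) 0 0 0 := by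
  refine ⟨fun p _ A _ => by simp, fun h => ?_⟩
  have := h (0, 0) (Set.mem_univ _)
  norm_num [firstOrderValue] at this

/-- C3 — hexp is LOAD-BEARING: the form `Q ≡ 0` satisfies hQ on any `𝓜`, yet with the datum `(−1, 0, 0, 0)` the
conclusion fails. [cite: Zhang2022LandauSiegel, §2 (2.32)] -/
theorem hexp_loadBearing :
    BAH (Set.univ : Set (ℝ × ℝ)) (fun _ _ => 0) 1 ∧ ¬ ModelConsistentOn (Set.univ : Set (ℝ × ℝ)) (-1) 0 0 0 :=
  ⟨fun _ _ _ _ => le_rfl, hQ_loadBearing.2⟩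

/-- C3 — the unpremised schema is FALSE on ADMISSIBLE members: the G5 v2 exponents with the datum `(−1,0,0,0)` on
`𝓜 = univ` form an admissible `DirectDesign` that is not model-consistent. [cite: Zhang2022LandauSiegel, §2 (2.32)] -/
theorem direct_unpremised_fails :
    ¬ ∀ d : DirectDesign, KDirect d → ModelConsistentOn d.𝓜 d.data.1 d.data.2.1 d.data.2.2.1 d.data.2.2.2 := by
  intro h
  exact hQ_loadBearing.2
    (h (directG5v2 ((-1 : ℝ), (0 : ℝ), (0 : ℝ), (0 : ℝ)) Set.univ (fun _ _ => 0) 1 0) (kdirect_G5v2 _ _ _ _ _))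

/-- C4 summary by term: each member kind is inhabited — the K₀ row `k₁ − k₃` (rows 45/46 of INTAKE-5 and, via its
discharged slots, row 47), an admissible formula-I member, an admissible two-sided member.
[cite: Zhang2022LandauSiegel, §2 (2.32)] -/
theorem bell_members_inhabited (data : ℝ × ℝ × ℝ × ℝ) (𝓜 : Set (ℝ × ℝ)) (Q : ℝ × ℝ → ℝ → ℝ) (A₀ K : ℝ) :
    KBell (.k0Plane 1 (-1) 0 (-(1 / 2))) ∧ KDirect (directG5v2 data 𝓜 Q A₀ K) ∧
      KTwoSided (twoSidedG6corner data data 𝓜 Q Q A₀ K K) ∧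
      KBell (.firstOrder (directG5v2 data 𝓜 Q A₀ K).data (directG5v2 data 𝓜 Q A₀ K).𝓜) :=
  ⟨(kbell_k0Plane_rows (-(1 / 2))).1, kdirect_G5v2 data 𝓜 Q A₀ K, ktwoSided_G6corner data data 𝓜 Q Q A₀ K K,
    kbell_firstOrder_of_direct _⟩


/-! ## Part 2 (APPEND v2, ls-Bell-typer-2 g3, 2026-08-27) — C2 FAITHFULNESS IN KERNEL FORM: §2 admissibility at the
P-sharp cap `x = 0` IS the tree's printed `T`-constraint list `EllRegime.TExponentConstraints` (registry E-027, typed by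
ls-Bell-typer-1) plus the `T`-free clause (f), under the dictionary «physical exponents `e = (ν₁, ν₂ − 10τ_T, ν₃, cut₁)`
of a `Repair.Theta`». Statements of Part 1 untouched. -/

/-- **(a)–(e) at `x = 0` ⇒ E-027's list.** For a design `θ : Repair.Theta` read on a sheet with `τ_T = τ`,
`τ_{t₀} ≥ 0`, `τ_{Dt₀} = α̃`: if its physical exponents `(ν₁, ν₂ − 10τ, ν₃, cut₁)` satisfy §2 (a)–(f) at the P-sharp
cap `X = 1 − 2τ`, then `TExponentConstraints θ τ τ_{t₀} α̃` ((T-i) = (c), (T-ii) = (d), (T-iii) ⇐ (a)(b)(c),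
(T-iv) ⇐ (T-iii) and `τ_{t₀} ≥ 0`, (T-v) = (e)). [cite: Zhang2022LandauSiegel, §2 (2.21); §7 (7.2); §12 Lemma 12.3; §14 (14.2); §15 (15.2)] -/
theorem tExponentConstraints_of_ellAdmissible_zero (θ : Theta) {τ τt0 α : ℝ} (ht : 0 ≤ τt0)
    (h : EllAdmissible 0 ⟨θ.nu1, θ.nu2 - 10 * τ, θ.nu3, θ.cut1⟩ ⟨τ, α⟩) :
    TExponentConstraints θ τ τt0 α := by
  obtain ⟨ha, hb, hc, hd, he, -⟩ := h
  simp only [capX, zero_mul, add_zero] at ha hb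
  have h3 : max θ.nu3 (θ.nu2 - 10 * τ) = θ.nu2 - 10 * τ := max_eq_right hc
  have hiii : max θ.cut1 (θ.nu2 - 10 * τ) + max θ.nu3 (θ.nu2 - 10 * τ) ≤ 1 - 2 * τ := by
    rw [h3]
    rcases le_total θ.cut1 (θ.nu2 - 10 * τ) with hle | hle
    · rw [max_eq_right hle]; linarith
    · rw [max_eq_left hle]; linarith
  exact ⟨hc, hd, hiii, by linarith, by linarith⟩

/-- **E-027's list + (f) ⇒ (a)–(f) at `x = 0`.** Conversely, `TExponentConstraints θ τ τ_{t₀} α̃` together with the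
`T`-free clause `1 < ν₁ + ν₃` gives §2 admissibility of the physical exponents at the P-sharp cap.
[cite: Zhang2022LandauSiegel, §2 (2.21); §7 (7.2); §12 Lemma 12.3; §14 (14.2); §15 (15.2)] -/
theorem ellAdmissible_zero_of_tExponentConstraints (θ : Theta) {τ τt0 α : ℝ}
    (h : TExponentConstraints θ τ τt0 α) (hf : 1 < θ.nu1 + θ.nu3) :
    EllAdmissible 0 ⟨θ.nu1, θ.nu2 - 10 * τ, θ.nu3, θ.cut1⟩ ⟨τ, α⟩ := by
  obtain ⟨h1, h2, h3, -, h5⟩ := h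
  have hm1 : θ.nu2 - 10 * τ ≤ max θ.cut1 (θ.nu2 - 10 * τ) := le_max_right _ _
  have hm2 : θ.cut1 ≤ max θ.cut1 (θ.nu2 - 10 * τ) := le_max_left _ _
  have hm3 : θ.nu2 - 10 * τ ≤ max θ.nu3 (θ.nu2 - 10 * τ) := le_max_right _ _
  refine ⟨?_, ?_, h1, h2, ?_, hf⟩
  · simp only [capX, zero_mul, add_zero]; linarith
  · simp only [capX, zero_mul, add_zero]; linarith
  · show 1 + α < θ.nu1 + (θ.nu2 - 10 * τ)
    linarith

/-- **C2 in kernel form**: at the P-sharp cap and `τ_{t₀} ≥ 0`, §2 (a)–(f) on the physical exponents of `θ` ⟺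
E-027's printed `T`-constraint list ∧ the `T`-free clause (f) — so the `x = 0` class of KILL-CERT §2 is EXACTLY the
tree's printed-hypothesis class, and the `x = 1` class the word quantifies over is its declared superset
(`ellAdmissible_zero_to_one`). [cite: Zhang2022LandauSiegel, §2 (2.21); §7 (7.2); §12 Lemma 12.3; §14 (14.2); §15 (15.2)] -/
theorem ellAdmissible_zero_iff_tExponentConstraints (θ : Theta) {τ τt0 α : ℝ} (ht : 0 ≤ τt0) :
    EllAdmissible 0 ⟨θ.nu1, θ.nu2 - 10 * τ, θ.nu3, θ.cut1⟩ ⟨τ, α⟩ ↔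
      TExponentConstraints θ τ τt0 α ∧ 1 < θ.nu1 + θ.nu3 :=
  ⟨fun h => ⟨tExponentConstraints_of_ellAdmissible_zero θ ht h, h.2.2.2.2.2⟩,
    fun h => ellAdmissible_zero_of_tExponentConstraints θ h.1 h.2⟩

/-! ### Part 2 §B — CS side: E-022's PER-MEAN remainder shape ⇒ row 48's premise `Repair.CSExactExpansion`
(lemma and proof contributed by the second reader ls-Blen-typer-2 g3, HOME/ls-Blen-typer-2/CsPerMean.lean
sha16 60155b754e29904c, (o3) 2026-08-27T01:05:02Z; pasted verbatim inside `namespace Repair`) -/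

/-- **Bridge (CS sheet): per-mean remainders ⇒ `CSExactExpansion`.** If a CS-edge member's three (A)-means are
`D(A) = D₀ + D₁/A + d(A)/A²`, `J(A) = J₀ + J₁/A + j(A)/A²`, `X(A) = X₀ + X₁/A + x(A)/A²` with E-022's per-mean
remainder shape `|d(A)|, |j(A)|, |x(A)| ≤ K′` for `A ≥ A₀ ≥ 1`, and Cauchy–Schwarz is EXACT at every such `A`
(B-AH (B1)), then INTAKE-5's displayed premise `CSExactExpansion c` holds, with the explicit bracket constant
`K = (|D₀|K′ + |D₁||J₁| + K′|J₀| + X₁² + 2|X₀|K′) + (|D₁|K′ + K′|J₁| + 2|X₁|K′) + 2K′²` — so row 48's hR (the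
ε²-tail bracket of `D(A)J(A) − X(A)²`, `EllRegime.csMargin_expansion`) is WEAKER than E-022's per-mean shape, as the
second read 01:00:50Z records (premise weaker ⇒ row stronger). [cite: Zhang2022LandauSiegel, §2 (2.32); §8 (8.23); §9 (9.1)] -/
theorem csExactExpansion_of_perMean (c : CSEdgeDesign) {A₀ K' : ℝ} {d j x : ℝ → ℝ} (hA₀ : 1 ≤ A₀)
    (hK' : 0 ≤ K')
    (hd : ∀ A, A₀ ≤ A → |d A| ≤ K') (hj : ∀ A, A₀ ≤ A → |j A| ≤ K') (hx : ∀ A, A₀ ≤ A → |x A| ≤ K')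
    (hCS : ∀ A, A₀ ≤ A → (c.X₀ + c.X₁ * (1 / A) + x A * (1 / A) ^ 2) ^ 2 ≤
        (c.D₀ + c.D₁ * (1 / A) + d A * (1 / A) ^ 2) * (c.J₀ + c.J₁ * (1 / A) + j A * (1 / A) ^ 2)) :
    CSExactExpansion c := by
  refine ⟨A₀, (|c.D₀| * K' + |c.D₁| * |c.J₁| + K' * |c.J₀| + c.X₁ ^ 2 + 2 * |c.X₀| * K') +
      (|c.D₁| * K' + K' * |c.J₁| + 2 * |c.X₁| * K') + (K' * K' + K' ^ 2), d, j, x,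
    lt_of_lt_of_le one_pos hA₀, fun A hA => ?_, hCS⟩
  have hA1 : 1 ≤ A := le_trans hA₀ hA
  have hApos : 0 < A := lt_of_lt_of_le one_pos hA1
  have hu0 : 0 ≤ 1 / A := by positivity
  have hu1 : 1 / A ≤ 1 := by rw [div_le_one hApos]; exact hA1
  have hdA := hd A hA
  have hjA := hj A hA
  have hxA := hx A hA
  -- the three groups
  have h1 : |c.D₀ * j A + c.D₁ * c.J₁ + d A * c.J₀ - c.X₁ ^ 2 - 2 * c.X₀ * x A| ≤
      |c.D₀| * K' + |c.D₁| * |c.J₁| + K' * |c.J₀| + c.X₁ ^ 2 + 2 * |c.X₀| * K' := by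
    have e1 : |c.D₀ * j A| ≤ |c.D₀| * K' := by
      rw [abs_mul]; exact mul_le_mul_of_nonneg_left hjA (abs_nonneg _)
    have e2 : |c.D₁ * c.J₁| ≤ |c.D₁| * |c.J₁| := (abs_mul _ _).le
    have e3 : |d A * c.J₀| ≤ K' * |c.J₀| := by
      rw [abs_mul]; exact mul_le_mul_of_nonneg_right hdA (abs_nonneg _)
    have e4 : |c.X₁ ^ 2| ≤ c.X₁ ^ 2 := (abs_of_nonneg (sq_nonneg _)).le
    have e5 : |2 * c.X₀ * x A| ≤ 2 * |c.X₀| * K' := by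
      rw [abs_mul, abs_mul, abs_two]
      exact mul_le_mul_of_nonneg_left hxA (by positivity)
    calc |c.D₀ * j A + c.D₁ * c.J₁ + d A * c.J₀ - c.X₁ ^ 2 - 2 * c.X₀ * x A|
        ≤ |c.D₀ * j A| + |c.D₁ * c.J₁| + |d A * c.J₀| + |c.X₁ ^ 2| + |2 * c.X₀ * x A| := by
          have := abs_add_le (c.D₀ * j A + c.D₁ * c.J₁ + d A * c.J₀ - c.X₁ ^ 2) (-(2 * c.X₀ * x A))
          have := abs_sub (c.D₀ * j A + c.D₁ * c.J₁ + d A * c.J₀) (c.X₁ ^ 2)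
          have := abs_add_le (c.D₀ * j A + c.D₁ * c.J₁) (d A * c.J₀)
          have := abs_add_le (c.D₀ * j A) (c.D₁ * c.J₁)
          have h' : |c.D₀ * j A + c.D₁ * c.J₁ + d A * c.J₀ - c.X₁ ^ 2 - 2 * c.X₀ * x A| ≤
              |c.D₀ * j A + c.D₁ * c.J₁ + d A * c.J₀ - c.X₁ ^ 2| + |2 * c.X₀ * x A| := abs_sub _ _
          linarith
      _ ≤ _ := by linarith
  have h2 : |c.D₁ * j A + d A * c.J₁ - 2 * c.X₁ * x A| ≤ |c.D₁| * K' + K' * |c.J₁| + 2 * |c.X₁| * K' := by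
    have e1 : |c.D₁ * j A| ≤ |c.D₁| * K' := by
      rw [abs_mul]; exact mul_le_mul_of_nonneg_left hjA (abs_nonneg _)
    have e3 : |d A * c.J₁| ≤ K' * |c.J₁| := by
      rw [abs_mul]; exact mul_le_mul_of_nonneg_right hdA (abs_nonneg _)
    have e5 : |2 * c.X₁ * x A| ≤ 2 * |c.X₁| * K' := by
      rw [abs_mul, abs_mul, abs_two]
      exact mul_le_mul_of_nonneg_left hxA (by positivity)
    have := abs_add_le (c.D₁ * j A) (d A * c.J₁)
    have h' : |c.D₁ * j A + d A * c.J₁ - 2 * c.X₁ * x A| ≤ |c.D₁ * j A + d A * c.J₁| + |2 * c.X₁ * x A| :=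
      abs_sub _ _
    linarith
  have h3 : |d A * j A - x A ^ 2| ≤ K' * K' + K' ^ 2 := by
    have e1 : |d A * j A| ≤ K' * K' := by
      rw [abs_mul]; exact mul_le_mul hdA hjA (abs_nonneg _) hK'
    have e2 : |x A ^ 2| ≤ K' ^ 2 := by
      rw [abs_pow]; exact pow_le_pow_left₀ (abs_nonneg _) hxA 2
    have h' : |d A * j A - x A ^ 2| ≤ |d A * j A| + |x A ^ 2| := abs_sub _ _
    linarith
  -- scale the second and third groups by `1/A ≤ 1`
  have g2 : |(c.D₁ * j A + d A * c.J₁ - 2 * c.X₁ * x A) * (1 / A)| ≤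
      |c.D₁| * K' + K' * |c.J₁| + 2 * |c.X₁| * K' := by
    rw [abs_mul, abs_of_nonneg hu0]
    calc |c.D₁ * j A + d A * c.J₁ - 2 * c.X₁ * x A| * (1 / A)
        ≤ |c.D₁ * j A + d A * c.J₁ - 2 * c.X₁ * x A| * 1 :=
          mul_le_mul_of_nonneg_left hu1 (abs_nonneg _)
      _ ≤ _ := by linarith
  have g3 : |(d A * j A - x A ^ 2) * (1 / A) ^ 2| ≤ K' * K' + K' ^ 2 := by
    rw [abs_mul, abs_of_nonneg (by positivity : (0 : ℝ) ≤ (1 / A) ^ 2)]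
    have hu2 : (1 / A) ^ 2 ≤ 1 := by nlinarith
    calc |d A * j A - x A ^ 2| * (1 / A) ^ 2 ≤ |d A * j A - x A ^ 2| * 1 :=
          mul_le_mul_of_nonneg_left hu2 (abs_nonneg _)
      _ ≤ _ := by linarith
  have := abs_add_le ((c.D₀ * j A + c.D₁ * c.J₁ + d A * c.J₀ - c.X₁ ^ 2 - 2 * c.X₀ * x A) +
      (c.D₁ * j A + d A * c.J₁ - 2 * c.X₁ * x A) * (1 / A)) ((d A * j A - x A ^ 2) * (1 / A) ^ 2)
  have := abs_add_le (c.D₀ * j A + c.D₁ * c.J₁ + d A * c.J₀ - c.X₁ ^ 2 - 2 * c.X₀ * x A)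
      ((c.D₁ * j A + d A * c.J₁ - 2 * c.X₁ * x A) * (1 / A))
  linarith


/-! ### Part 2 §C — KILL-CERT(B-ell) v1 5625bef2660f98d2 §2 «The class D_ell» VERBATIM (REF-E v0.45 N1: «a
docstring-only part quoting §2 verbatim is welcome»; INTAKE-5 renders §2 as a table + embedding paragraph, this block
QUOTES it; byte source B-ell/KILL-draft.md, the §2 section body as countersigned v0.7.2–v0.8, «> »-prefixed, no other
change)

> ## 2 · (a) The class D_ell (declared design space; REF-B2 audits THIS text)
> Lens fixed: F_ℓ = `Literature.NumberTheory.LFunctions.Zhang2022.mainTermFormEll ℓ`, ℓ = L_R/L_Δ = 1 + ε, ε = 1/(2A+1+2τ₀·…) per sheet (D-ell-1a exact scales: y ↦ y·A/(A+1+2B), ε = 1/(2A+1+4B) on B-sheets; t₀-regime per sheet CONFIRMED by theory (γ) 22:47:47Z: C = 0 for printed-frame rows, C = 2B for T-room rows, via `EllRegime.EllDictFirstOrderLamC` (p462342), never mixed across a row). A design = PHYSICAL data chosen after A (frame of record, RULING-2 18:12:09Z; sup over z′-designs frame-invariant, agreed num-1/num-2/plan 18:23:58Z). **[v0.7.2 FIXED-DESIGN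 CLAUSE, theory 00:03:26Z]** Every member is a FIXED design: its profile SHAPES (pieces, breakpoints as exponents y of P, tent/PPE coefficients, twists k, ι) are A-INDEPENDENT — fixed as A → ∞ — except through the declared O(1/A) admissibility re-tuning of breakpoint POSITIONS at fixed y₀ > 0 (the (A,B)-formulas of DESIGN-MAP §0, whose first-order effect is part of dict-1, components (a)(c)(g)); no member has profile structure at scales that shrink with A, and in particular none in the wall layer y ≤ (½+δ)/A (m ≤ D^{1/2+δ}), where the first-order functional sees only G(0) + G′(0)·z (theory U4 clause); A-indexed collections of designs (the corner family re-tuned at every A, the G6 argmax per grid point, the REACH anchors, scale-free σ′ windows read at δ fixed per design) enter the word INSTANCE-BY-INSTANCE as fixed designs at each A — every design file of record satisfies this clause (piecewise-linear/PPE profiles with O(1) breakpoints); a design violating it (structure at y ≲ 1/A) is OUTSIDE D_ell and would be an (α)/U4-type §D object. Pieces of a design: pieces (side-1 dual profile g₁ on [0, cut] ∪ probe on [cut, e₁], side-2 profile g₂ on [0, e₂], side-3 on [0, e₃]), free coefficients ι, twist exponents k (AFE directions (1,0,−1), (0,1,1), (−1,−1,0): `afeDir`), T-length exponent B (T = D^B),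 t₀; ADMISSIBILITY = printed ν-slab with T-rooms on physical exponents (PARAMS §7 (i)–(vii) ≙ `EllRegime.TExponentConstraints`): (a) 2e₂ ≤ X, (b) cut+e₂ ≤ X, (c) e₃ ≤ e₂, (d) e_j < 1−2τ, (e) e₁+e₂ > 1+α̃, (f) e₁+e₃ > 1, X = 1 + x·α̃ − 2τ, x ∈ {0 (P-sharp caps — large-sieve/orthogonality origin), 1 (conductor-natural caps — AFE-truncation origin)}: theory (α) 22:47:47Z decides caps BY ORIGIN; in Zhang's frame the two coincide (D = P^{𝓛⁻⁸}); the KILL quantifies over the LARGER class x = 1 ⊃ x = 0 and a KEEP requires admissibility at x = 0; a D-explicit re-derivation of (14.2)/(15.2) is the derivation row ell-E14 (EDLIST v1.14; x-sensitivity flag, affects KEEP-admissibility only). Sub-families: F-R (reflection-frame ties/tents, cut = z₂ = ½: INADMISSIBLE as tabulated at x = 0 — kept as the σ′ = 0 limit), G5 v1/v2 (σ′-deformed admissible ties, three splits), G5 v2b (SCOUT-4 resonant twists), G6 (admissible sup = the class's main-order object), G2/G2b/G4/G4b (k₂ = 13/5 and mirror-J₂ T-shift probes), F-P (Zhang's log-P-proportional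 lengths held fixed: robustness/mistuning column only), block C free top-vanishing profiles (single-lineage HEUR, «pre»), K₀-POS (u = k₁−k₃, k₁+k₂, k₂+k₃: one-piece wall-vanishing profiles `EllRegime.OnePieceWV`, main term ≥ 0 in the physical frame BY THEOREM p465723/p466709 — the unit-scale values F_ℓ(u) < 0 need support to L_R > log P and are the exit K₀^R = E*-len, NOT a member [v0.5.2: K₀^R «A free» reading WITHDRAWN since MAP v0.16]; K₀^P = mistuning row); G6’s CS-edge corner family (z₃ = z₂ = cut = c, δ = 2(1−2c), reflected side-2 onset at the probe peak) is a member ((a)–(f) hold; ruling 21:03:48Z), its confluent residue weights are a dict-1 matter. Explicit clauses (F2): ELL-D = CI02/pair-correlation-conditional lookups (block D) are OUTSIDE D_ell (conditional inputs, §C/§D rows of the census; price endpoints in print: Lagarias–Rodgers AAP 2021 Thm 1.8/Cor 1.9 — support ≤ 1 zero-side input never excludes AH — vs Walker IJNT 2023 Thm 10 under AP(8/15), lit SH-089); ELL-E = ℓ < 1 is NOT realisable (`one_lt_ellOf`); the B ≤ ½ sub-sheet reads «no (open row E-016, XL)» — a kill-by-price clause the charter allows, not first-order emptiness; block-C free PPE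 profiles ARE inside D_ell and inside G6’s admissible sup (G6 ⊕ M3, ls-Bmulti-num-1 tasked 19:02:11Z: full PPE coefficient pencil in the admissible σ′-frame) — until G6 lands their rows stay «pre» with no M column. NOT in D_ell: coefficient mass beyond the dual length (E*-len), height/t-averaging (anti-lever), in-class levers L1–L16 (closed by `Repair.not_repairable_true_need` p428635). **AUDIT ITEMS PRINTED (REF-B2 §2 class audit 22:21:55Z, for the countersign):** (n1/n2) the δ- and k-CONTINUA of PLAN §5 are covered in TIER-1 (first-order, structural) currency ONLY — `not_closesFirstOrderOn_of_expansion` quantifies over every design of the class at once GIVEN B-AH|_U ∧ hexp; the numeric sub-certificates cover GRIDS × A-WINDOWS and the certified A-CONTINUA of record (σ′ windows, closure, M2 halves, tied-A6000 anchor [200.79, 6093.05], REACH chains, δ-family CS intervals) and nothing else; no number speaks for a continuum it did not certify. (n5) ELL-B (B-θ, tie designs with endgame POS / ι-block indefinite): DISPOSED «no» — the POS event needs A ≤ ≈ 376 (single-lineage B j255797 = L11 j251235), below the zero-model floor ≈ 920 and the (14.8) floor 1667; PLAN's two confirmation rows were conditional on a KEEP and were not run; (B-K₀) = clause (I). (n7)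 the KILL is certified on the x = 1 SUPERSET of admissible designs; the x = 0 class ⊂ it; every two-lineage table carries both x columns where the design depends on x. (n8) SHIFT VECTOR: Zhang's (2.13) b = (1, 2, 3) − c′α𝓛·(5, −2, 3) is FIXED for every member (ruling 22:44Z; c′ = c′_det(τ₀) + c′_ar an (A)-world datum, not a dial); lattice-tied / re-centred shift designs are the exit «shift redesign» (D-ELL-2 at u*: first order 0, second order +4(1+τ₀)²π‖g‖²/2 per A² > 0, deriv-1 23:05:16Z) and detector-shift redesign is §B-det's axis — neither is a member. (n10) F-R at x = 1: the cap offset is σ′ = λ[(1−x)α̃/2 + τ] = λ·B/A > 0 on the B = 0.51 and B = 2.5·10⁻⁴A sheets ⇒ F-R (cut = z₂ = ½, σ′ = 0) stays INADMISSIBLE there at x = 1 too (it is the σ′ → 0 limit of G5 v2); on the reference sheet B = 0 at x = 1, σ′ = 0 and the F-R rows coincide with G5 v2 at σ′ = 0 — admissible, read as block A/A2's two-lineage ε-only windows (main order non-empty on bounded windows; first order = TIER 1). (K₀) «K₀-POS» = the COMPLEX PLANE span{k₁+k₂, k₂+k₃} with ι ∈ ℂ² free (clause (I)), not three vectors.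
-/

/-- C4 (III′), a CLOSED subcritical witness (REF-E v0.45 N2, referee scratch `refE_subcritical_member`): the scale
record `⟨D, L_M, log T, t₀, 𝓛₁, 𝓛₂, η⟩ = ⟨65, 1, 1, 1, 1, 1, 1⟩` with the prime-window point `p = 1` is a member of
INTAKE-5's row 49 (`4π² ≤ 64 < 65` by `Real.pi_le_four`; `1 < √65`). [cite: Zhang2022LandauSiegel, §2 (2.10)] -/
theorem kbell_subcritical_closed : KBell (.subcritical ⟨65, 1, 1, 1, 1, 1, 1⟩ 1) := by
  refine kbell_subcritical one_pos (show (0 : ℝ) < 1 from one_pos) ?_ ?_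
  · show 4 * π ^ 2 < ((65 : ℕ) : ℝ)
    have hπ := Real.pi_le_four
    have hπ0 := Real.pi_pos
    push_cast
    nlinarith
  · show (1 : ℝ) < 1 * Real.sqrt ((65 : ℕ) : ℝ) * 1
    have h65 : (1 : ℝ) < Real.sqrt 65 := by
      rw [show (1 : ℝ) = Real.sqrt 1 from Real.sqrt_one.symm]
      exact Real.sqrt_lt_sqrt (by norm_num) (by norm_num)
    push_cast
    simpa using h65


/-! ## Part 3 (APPEND v3, ls-Bell-typer-2 g4, 2026-08-27) — N2 OF RECORD: the slot `hexp_II` after D-ELL-1c-II v0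
(ls-Bell-deriv-1 g2: STRUCTURE line 2026-08-27T01:44:10Z; `B-ell/deriv-1/D-ELL-1c-II.md` v0 sha16 abc3095dc8f3438b,
LANDED 02:03:35Z, + desk twin `dict2.py` 8303c18bbda20eee; v0.1 8f8c639812d77c2b 02:13:26Z = v0 with the one open
Level-2 item desk-closed, NO Level-1 change; label DERIVATION (Level 1) / HEUR (Level 2) until ls-theory's
second signature; referee ls-B-ref-2 g1; fold of record = ls-Bell-plan g2's KILL-CERT(B-ell) v1.1).  Statements of
Parts 1–2 UNTOUCHED; this Part adds slot ALGEBRA and a READING (definitions with bodies + theorems; no number of the cell,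
no named fact, D-0026).

**SHAPE CHECK OF RECORD (typer's N2 word, posted 01:48:44Z, AGREED by REF-B2 01:49:04Z and ls-theory 01:53:59Z; final on
v0 §6.3).**  The formula-II first-order dictionary of a two-sided member — the cross term `Ξ₁₃ = Ξ₁₄ + Ξ₁₅`, `Ξ₁₄ =
−i(Φ₁+Φ₂−Φ₃)` ((13.7); §§15–17) resummed at finite `A` to `F0_A` (the `T`-frame CANCELLING identically: v0 Thm 4.1,
kernel twin `Det.glueAssembledA_eq` of `Zhang2022/EllGlueFiniteA.lean`), plus the overhang `Ξ₁₅` reflected into formula I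
by `R̃_A : z ↦ 1 + α̃ − z` (§12), plus the reflected square — expands about the model point as
`X_A(d) = X(d) + [πc′·𝒟_II(d) + (τ₀/2)·𝒯_II(d) + (1 + τ₀/2)·𝒜_II(d)]/A + O(A⁻²)` (v0 §6.1/§6.3: `𝒟` detuning, `𝒯`
`t₀`-phase, `𝒜 = ∂_{α̃}` reflection-frame functional — the one with no one-piece analogue; NO `T`/`B_T` datum).  THIS IS
EXACTLY THE TREE SLOT `Repair.HExpII 𝓜 QII dataII A₀ K₂` (`= HExp`; value `EllRegime.firstOrderValue gain G₀ G₁ G₂ (λ, c′)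
= gain + G₀ + λ·G₁ + c′·G₂`) with `dataII = Repair.dictIIData 𝒟_II 𝒯_II 𝒜_II G₁^{II} τ₀`, i.e. `G₂^{II} = π·𝒟_II`,
`G₀^{II} = (τ₀/2)·𝒯_II + (1+τ₀/2)·𝒜_II` (a SHEET CONSTANT — `τ₀` is a coordinate of the sheet, not of the model datum
`p = (λ, c′)`; convention D3 of D-ELL-1-K0, as the K₀ plane's `G₀ = −4πτ₀S`), `gain = 0`, and `G₁^{II}` the Level-2
`λ`-column (robustness DISPLAY only under ls-theory's (δ2) / `EllRegime.EllLambdaPinned`, p476746: the `λ`-terms, the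
arithmetic constant `C₂` — closed in v0 §7.5 at order `1/(A·log D)` AND model-universal — and the `Φ₃⁺`
atom-channel bracket (v0 §3.4, convention `κ₊` of the `λ`-column) are `o(1/A)` at fixed `A`, not first-order data) —
`firstOrderValue_dictIIData`.  Hence: NO new slot, NO
new sheet parameter, NO statement change; the director's qualifier (b) reads OUTCOME (A) on v0 (three-way table
01:51:12Z; REF-B2's verdict and ls-theory's signature are steps (1)–(2) of the fold).

**CENTRED-PIECE READING (recorded, not a statement change).**  The per-piece slots `HExp` (direct) / `HExpII` (reflected)
have ZEROTH ORDER `0`, while D-ELL-1c-II's pieces carry their own main-order values (`X(d)` above: e.g. the cross block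
`Re 𝔠₃ → −6.9909` at `θ₀`, v0 §6.2): `QI` / `QII` are read on the CENTRED pieces (piece minus its own `A → ∞` value); the
centrings sum to the member's TOTAL main order — stratum (I)'s object (`𝔅`-PSD, `EllRegime.mainTerm_frame_nonneg`) —
which vanishes exactly on the members TIER 1 is about (total-main-order-null directions, e.g. the `ι*`-direction of a
CS-edge member), where hQ = B-AH on `QI + QII` is the exact form verbatim.

«The programme SEARCHES and TYPES; no claim about Landau–Siegel zeros, Theorems 1–2 of arXiv:2211.02515 or a repaired
Margin232 until a kernel theorem says so.» -/

/-! ### Part 3 §A — the v0 shape IS an instance of the slot's value -/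

/-- **D-ELL-1c-II's first-order datum of the reflected piece, as slot data**: from the three structural functionals
`(𝒟_II, 𝒯_II, 𝒜_II)(d)` of v0 §6.3, the Level-2 `λ`-column `G₁^{II}(d)` and the sheet's `τ₀`, the quadruple
`(gain, G₀, G₁, G₂) = (0, (τ₀/2)·𝒯_II + (1+τ₀/2)·𝒜_II, G₁^{II}, π·𝒟_II)`. [cite: Zhang2022LandauSiegel, §13 (13.7); §15 (15.24); §16 (16.17); §17 (17.10); §12 (12.8); §2 (2.13)] -/
def dictIIData (D T Acal G₁ τ₀ : ℝ) : ℝ × ℝ × ℝ × ℝ :=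
  (0, τ₀ / 2 * T + (1 + τ₀ / 2) * Acal, G₁, π * D)

/-- **The v0 shape IS the slot's value:** at the datum `p = (λ, c′)`,
`firstOrderValue (dictIIData 𝒟 𝒯 𝒜 G₁ τ₀) p = πc′·𝒟 + (τ₀/2)·𝒯 + (1+τ₀/2)·𝒜 + λ·G₁` — D-ELL-1c-II §6.3's display
(`+ λ·G₁`, the Level-2 column) verbatim. [cite: Zhang2022LandauSiegel, §2 (2.13), (2.32); §13 (13.7)] -/
theorem firstOrderValue_dictIIData (D T Acal G₁ τ₀ : ℝ) (p : ℝ × ℝ) :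
    firstOrderValue (dictIIData D T Acal G₁ τ₀).1 (dictIIData D T Acal G₁ τ₀).2.1 (dictIIData D T Acal G₁ τ₀).2.2.1
        (dictIIData D T Acal G₁ τ₀).2.2.2 p
      = π * p.2 * D + τ₀ / 2 * T + (1 + τ₀ / 2) * Acal + p.1 * G₁ := by
  simp only [firstOrderValue, dictIIData]
  ring

/-- At the model point of a sheet (`λ = 0`, `c′ = c′_det(τ₀) = (1+τ₀)/(2π)`, `EllRegime.EllLambdaPinned` / Lemma 2.3
admissibility) the value is `G₀^{II}(c′_det) = (1+τ₀)/2·𝒟 + (τ₀/2)·𝒯 + (1+τ₀/2)·𝒜` (v0 §6.2's «G₀^{II}(c′_det, τ₀)»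
columns are this number at `θ₀`; no number enters here). [cite: Zhang2022LandauSiegel, §2 Lemma 2.3, (2.13), (2.15)] -/
theorem firstOrderValue_dictIIData_model (D T Acal G₁ τ₀ : ℝ) :
    firstOrderValue (dictIIData D T Acal G₁ τ₀).1 (dictIIData D T Acal G₁ τ₀).2.1 (dictIIData D T Acal G₁ τ₀).2.2.1
        (dictIIData D T Acal G₁ τ₀).2.2.2 ((0 : ℝ), (1 + τ₀) / (2 * π))
      = (1 + τ₀) / 2 * D + τ₀ / 2 * T + (1 + τ₀ / 2) * Acal := by
  rw [firstOrderValue_dictIIData]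
  have hπ : (π : ℝ) ≠ 0 := Real.pi_ne_zero
  field_simp
  ring

/-! ### Part 3 §B — slot algebra for the two-sided members (the shape v0 delivers piece by piece) -/

/-- **hexp_II assembled from its two printed pieces.** If the reflected SQUARE piece (`Ξ₁₂/(𝔞𝔓)`, centred form `Qsq`,
data `dSq`, remainder `Ksq`) and the CROSS piece (`2Re Ξ₁₃/(𝔞𝔓)`, bulk `Ξ₁₄` + overhang `Ξ₁₅`; centred form `Qx`, data
`dX`, remainder `Kx`) of a two-sided member each satisfy the expansion slot on `𝓜` from `A₀` on, then the member's
reflected piece `QII := Qsq + Qx` satisfies `HExpII` with `dataII := addData dSq dX` and `K₂ := Ksq + Kx`.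
[cite: Zhang2022LandauSiegel, §9 (9.7); §13 (13.7)–(13.8); §15 (15.15)–(15.17); §17 (17.1), (17.10)] -/
theorem hexpII_of_pieces {𝓜 : Set (ℝ × ℝ)} {Qsq Qx : ℝ × ℝ → ℝ → ℝ} {dSq dX : ℝ × ℝ × ℝ × ℝ} {A₀ Ksq Kx : ℝ}
    (hsq : HExp 𝓜 Qsq dSq A₀ Ksq) (hx : HExp 𝓜 Qx dX A₀ Kx) :
    HExpII 𝓜 (fun p A => Qsq p A + Qx p A) (addData dSq dX) A₀ (Ksq + Kx) :=
  hexp_add hsq hx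

/-- **The three slots of a two-sided member give the expansion slot of its TOTAL form** `QI + QII` against the summed
data (the object hQ = B-AH|_{U ∪ U_II} is stated on), with remainder `K₁ + K₂`. [cite: Zhang2022LandauSiegel, §2 (2.32); §9 (9.1); §13 (13.7)] -/
theorem hexp_total_of_twoSided (d : TwoSidedDesign) (hexp : HExp d.𝓜 d.QI d.dataI d.A₀ d.K₁)
    (hexpII : HExpII d.𝓜 d.QII d.dataII d.A₀ d.K₂) :
    HExp d.𝓜 (fun p A => d.QI p A + d.QII p A) (addData d.dataI d.dataII) d.A₀ (d.K₁ + d.K₂) :=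
  hexp_add hexp hexpII

/-- **Monotonicity of the slot in the threshold and the remainder constant** (a delivered `(A₀′, K′)` may be weakened
to any `A₀ ≥ A₀′` with `A₀ > 0` and `K ≥ K′` — e.g. when members are tabulated with a common threshold).
[cite: Zhang2022LandauSiegel, §2 (2.32); §9 (9.1)] -/
theorem HExp.mono {𝓜 : Set (ℝ × ℝ)} {Q : ℝ × ℝ → ℝ → ℝ} {data : ℝ × ℝ × ℝ × ℝ} {A₀ A₀' K K' : ℝ}
    (h : HExp 𝓜 Q data A₀' K') (hA : A₀' ≤ A₀) (hA0 : 0 < A₀) (hK : K' ≤ K) : HExp 𝓜 Q data A₀ K := by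
  intro p hp A hAA
  have hApos : 0 < A := lt_of_lt_of_le hA0 hAA
  exact (h p hp A (le_trans hA hAA)).trans (div_le_div_of_nonneg_right hK (by positivity))

/-! ### Part 3 §C — REF-E v0.46 (3) E-32 NOTE OF RECORD (n-α), in the kernel -/

/-- **Row 47's displayed premise is EQUIVALENT to its verdict** — `FirstOrderExpansion 𝓜 data ↔ ModelConsistentOn 𝓜
data` (⇒ is p470105; ⇐ takes the exact form `Q_A := value/A`, `K = 0`).  Reading (ls-barrier-ref g2 01:14:37Z, E-32
NOTE): the content of stratum (II) is NOT in row 47 as a family but in each MEMBER's slots `BAH` / `HExp` (/ `HExpII`) for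
ITS OWN (A)-world form `Q` — coverage is booked member by member; premise-free `D_ell` rows are 45, 46, 49 and the K₀
plane inside 47 (`k0Plane_slots`). [cite: Zhang2022LandauSiegel, §2 Lemma 2.3, (2.32)] -/
theorem firstOrderExpansion_iff_modelConsistentOn (𝓜 : Set (ℝ × ℝ)) (data : ℝ × ℝ × ℝ × ℝ) :
    FirstOrderExpansion 𝓜 data ↔ ModelConsistentOn 𝓜 data.1 data.2.1 data.2.2.1 data.2.2.2 := by
  refine ⟨fun h => familyBellFirstOrder_decided (data, 𝓜) trivial h, fun h p hp => ?_⟩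
  refine ⟨1, 0, fun A => firstOrderValue data.1 data.2.1 data.2.2.1 data.2.2.2 p / A, one_pos,
    fun A hA => div_nonneg (h p hp) (by linarith), fun A _ => by simp⟩

/-- Hence a member's slots hQ ∧ hexp are dischargeable for SOME form `Q` iff the verdict holds for its data — the slots
bite only through the member's OWN form (the (A)-world discrete mean), for which hQ = B-AH|_U is the named, unproved
premise E-014. [cite: Zhang2022LandauSiegel, §2 Lemma 2.3, (2.15), (2.32)] -/
theorem exists_slots_iff_modelConsistentOn (𝓜 : Set (ℝ × ℝ)) (data : ℝ × ℝ × ℝ × ℝ) :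
    (∃ (Q : ℝ × ℝ → ℝ → ℝ) (A₀ K : ℝ), 0 < A₀ ∧ BAH 𝓜 Q A₀ ∧ HExp 𝓜 Q data A₀ K) ↔
      ModelConsistentOn 𝓜 data.1 data.2.1 data.2.2.1 data.2.2.2 := by
  constructor
  · rintro ⟨Q, A₀, K, -, hQ, hexp⟩
    exact modelConsistentOn_of_slots hQ hexp
  · intro h
    refine ⟨fun p A => firstOrderValue data.1 data.2.1 data.2.2.1 data.2.2.2 p / A, 1, 0, one_pos,
      fun p hp A hA => div_nonneg (h p hp) (by linarith), fun p _ A _ => by simp⟩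


/-! ## Part 4 (APPEND v4, ls-Bell-typer-2 g5, 2026-08-27) — docstring ERRATUM to Part 3's `C₂` sentence (REF-B2 =
ls-B-ref-2 g1: VERDICT on D-ELL-1c-II v0.1 sha16 a2a6fc69ab2f95a3, 2026-08-27T02:23:30Z, correction (c1); post-landing read
of p486704, 02:24:39Z) + the LABEL OF RECORD after ls-theory's SECOND SIGNATURE (02:36:48Z) — no declaration is touched;
statements of Parts 1–3 frozen; no number enters a declaration

Part 3's header above says, inside the parenthesis on the Level-2 `λ`-column `G₁^{II}`: «the arithmetic constant `C₂` —
closed in v0 §7.5 at order `1/(A·log D)` AND model-universal».  The words «AND model-universal» are SUPERSEDED (they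
inherit `D-ELL-1c-II.md` v0.1 §7.5(ii)'s wording, which the referee does not derive).  The sentence OF RECORD (REF-B2
(c1), verbatim in substance): «`C₂` enters at order `1/(A·log D)` (Level 2); `C₂ = C₂[λ] = 2.113` AT THE DRESSED MODEL
POINT (deriv-1 `c2_check.py` b6d5a3f4e2126d8d, N = 10⁶: 2.113364; the referee's `c2_exact.py` 16c06dc8c3031135,
N = 2·10⁶: 2.113365 — two codes, agreement 1e-6; REF-B2 (c3): the referee's earlier Simpson value 2.12672 is withdrawn and
v0 §0.5's display «≈ 2.12» reads 2.113; `D-ELL-1c-II.md` v0.2 §7.5 carries the corrected sentence); ACROSS Box((A))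
the ratio `C₂/L′²` is an `O(1)` `χ`-DEPENDENT number through `χ(p)`, `p = O(1…10²)` — universality across Box((A)) is NOT
derived (hypothesis (A) pins `Σ_p χ(p)/p` only in aggregate; a split small prime costs a bounded Euler factor absorbed by
the exceptional-zero tail and by `L′`); Level 2 either way.»  The same caveat («under the dressed model») covers the
`Φ₃⁺` atom-channel bracket `k = −ζ′(2)/ζ(2)` of v0.1 §3.4 that Part 3 files under the convention `κ₊` of the `λ`-column.

WHAT IS UNCHANGED, and why no statement moves: OUTCOME (A) of the director's three-way table (01:51:12Z; director-frontier
g6 02:27:14Z «QUALIFIER (b): NOT FIRED. OUTCOME (A) OF RECORD»; ls-lead «N2 BOOKED» 02:24:22Z; REF-B2 SURVIVES 8/8 + JOINT)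
rests on the ORDER leg alone — `C₂` and `k` sit at order `1/(A·log D)`, i.e. `o(1/A)` at fixed `A`, inside the Level-2
column `G₁^{II}` of `Repair.dictIIData` (robustness DISPLAY only, under ls-theory's (δ2) / `EllRegime.EllLambdaPinned`,
p476746), and NOT among the Level-1 data `(c′, τ₀, α̃)` of the slot `Repair.HExpII`; Part 3 states the order leg too, and
that statement stands.  Hence: `dictIIData`,
`firstOrderValue_dictIIData(_model)`, `hexpII_of_pieces`, `hexp_total_of_twoSided`, `HExp.mono`,
`firstOrderExpansion_iff_modelConsistentOn`, `exists_slots_iff_modelConsistentOn` — all untouched; no slot, sheet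
parameter or premise of INTAKE-5 (`RepairIntakeBell`, p479175) changes; qualifier (b) still does not fire.

LABEL OF RECORD — Part 3's clause «DERIVATION (Level 1) / HEUR (Level 2) until ls-theory's second signature» is CLOSED
by that signature: ls-theory g2, SECOND SIGNATURE 2026-08-27T02:36:48Z on `D-ELL-1c-II.md` v0.2 sha16 c94f1945160935d0
(Level-1 bytes = v0.1 a2a6fc69ab2f95a3): **DERIVATION (Level 1) / HEUR (Level 2, robustness column only) CONFIRMED**;
theory (t1) «`C₂` sits in Level 2, (A)-dependent, never in a word» (= REF-B2 (c1) above); READING 2.1 (B-coefficients =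
`χψ(n)·b(n)`, `b` character-free) is an IDENTITY, not an interpretive step: `B♯ = (H₁₄♯ + ι₂H₁₂♯)H₂♯` (12.2)
[corpus:paper:arxiv-2211.02515 p0024:L18] is a product of Dirichlet polynomials in the completely multiplicative `χψ`, so
`B♯ = Σ_n b(n)·χψ(n)·n^{−s}` (15.1) [corpus:paper:arxiv-2211.02515 p0030:L6] with `b` the character-free profile
convolution (theory's TeX locators l.3370 / l.3981; macro `\pc = χψ` l.45); Thms 4.1/4.2 re-derived by hand = the kernel
twins `Det.glueAssembledA_T_frame_cancels` / `Det.bj_mul_glueWA` (`EllGlueFiniteA`, p486167); NO `χ`-dependent constant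
is re-classified to Level 1 ⇒ no statement event, no extra (A)-world datum slot (had there been one, it would be a later
Part with new slots, never a docstring).  EDGE recorded by theory for KNIFE-EDGES §B-ell (§8.4 of v0.2), not a word and
not a statement here: the two-sided first-order no-close reading is GIVEN `c′ ≥ c′_det(τ₀)` — the model point of
`firstOrderValue_dictIIData_model` — with margin ≈ ×2 (V12) / ×3 (θ₀ pair space); at `c′ = 0` the K_ell directions close
at `O(1/A)` on the `τ₀ = 0` sheet (the `𝒜`-term), the K₀ structure with a thinner margin.  This file imports nothing
new; the pointers are the record.  Writer of this append: ls-Bell-typer-2 g5.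
[cite: Zhang2022LandauSiegel, §12 (12.2); §15 (15.1)]  «The programme SEARCHES and TYPES; no claim about Landau–Siegel
zeros, Theorems 1–2 of arXiv:2211.02515 or a repaired Margin232 until a kernel theorem says so.» -/

end Repair

end Literature.NumberTheory.LFunctions.Zhang2022

end
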